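import Summits.BirchSwinnertonDyer.BirchSwinnertonDyer.Theorems.PrintX9HeegnerRankOnePair
import Summits.BirchSwinnertonDyer.BirchSwinnertonDyer.Theorems.Rank1ResidualX9CMPartner
import Summits.BirchSwinnertonDyer.BirchSwinnertonDyer.Theses.PrintX9
import Summits.BirchSwinnertonDyer.Rank1Residual.X11b.Three.KolyvaginLine
import Summits.BirchSwinnertonDyer.Rank1Residual.X11b.BDPRouteRankOneBookkeeping
import Summits.BirchSwinnertonDyer.Rank1Residual.X11b.KolyvaginBottomPoint
import Literature.NumberTheory.EllipticCurves.HeegnerPointsKolyvaginPrimaryGeneratorProofs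
import Literature.NumberTheory.EllipticCurves.Cha2005.ShaStructureIrreducible
import Literature.NumberTheory.EllipticCurves.BSDSelmerCMPConverseHeegnerFieldProofs
import HarnessLib

/-!
# Class X9, the HEEGNER ROAD with the Tamagawa residual REMOVED: route `PrintX9`'s crux
# `HeegnerDivisibilityX9` (item 20392: derived Heegner points `p^s`-divisible to depth
# `t = ord_p ∏ c_ℓ(E)` on X9 frames — Jetchev–W. Zhang's `M_∞ ≥ t`) + Kolyvagin's structure theorem
# under IRREDUCIBILITY (Cha 2005 Rmk. 25) give the Tamagawa-SHARP upper bound over `K`; with STEP L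
# from print and the K6 typed rank-`0` engine at the twist this yields the LEAF `BSDpOnClassX9` —
# a Schneider-free ASSEMBLY for route `PrintX9`: `HeegnerDivisibilityX9 → MuTransfer → AnalyticMuZeroX9 → print → leaf`
# (cell `bsd-print-x9`, prover seat p4; companion of `PrintX9Heegner{RankOne,IMCLink,RankOnePair,Leaf}.lean`)

HONEST FRAMING (cell `run/shared/lean/pub/bsd-print-x9/`, D-0131 print tier): THEOREMS ONLY (no
definition, no named fact, no `sorry`); every published theorem enters as one of the tree's named
Literature facts BY NAME; every unproved statement enters as an EXPLICIT binder — here the route decl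
`Theses.PrintX9.HeegnerDivisibilityX9` (item 20392, OPEN) and the K6 typed rank-`0` engine
`IntegralMainConjectureOnClassX9` (= `KatoMuTransfer ∧ AnalyticMuZeroOnClassX9`, items 19629/19630,
OPEN). Nothing about any particular curve is asserted; no label changes; the leaf is NOT closed
(currency: crux-record / conditional bridge).

## What this file proves

`PrintX9HeegnerLeaf.lean` reached the leaf modulo the named residual «rank one ∧ `p ∣ ∏ c_ℓ(E)`»
(Matar–Nekovář's depth-`0` bound meets STEP L only when `ord_p ∏ c_ℓ(E) = 0`). Route `PrintX9` (rev 0)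
carries exactly the missing input as its crux J = `HeegnerDivisibilityX9`: on every Manin-good X9 frame over a large Heegner field with `p`
split, every derived Heegner point `P_n` is `p^s`-divisible for `s ≤ t = ord_p ∏ c_ℓ(E)`. Fed into
the UPPER half of Kolyvagin's structure theorem under irreducibility (Cha 2005 Thm. 21 + Rmk. 25,
Matar–Nekovář 2019 §0.11; tree fact `Cha2005.rmk25_padicValNat_card_sha_primary_add_le_of_globalDivisibility`,
flag `Cha05-Rmk25-structure`) it gives `ord_p #Ш(E/K) + 2t ≤ 2·ord_p[E(K):ℤP]` — §1, the good-`p` twin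
of `Three.Koly.shaIndexBound_sharp_of_globalDivisibility_of_irreducible` (which asks `p ∥ N`) — and
with STEP L (`2·ord_p[E(K):ℤP] ≤ ord_p #Ш(E/K) + 2t`, from BCS 2025 Thm. 1.2.4 (a) + Prop. 4.2.2 ∘
CGLS 5.1.3 + JSW 3.3.1, `PrintX9HeegnerIMCLink.lean`) the Heegner-index IDENTITY over `K` at EVERY
rank-one X9 pair, Tamagawa-divisible or not (§2). The descent `X11b.bsdp_of_indexIdentityAt` with the
K6 engine at the twist then gives `BSD(E,p)` (§3), and §4 the leaf:

* `bsdpOnClassX9_of_heegnerDivisibilityX9_of_integralMainConjectureOnClassX9` — `BSDpOnClassX9` ⟸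
  PUBLISHED facts ∧ `HeegnerDivisibilityX9` (20392) ∧ `IntegralMainConjectureOnClassX9`;
* `bsdpOnClassX9_of_heegnerDivisibilityX9_of_katoMuTransfer` — the same from the route items
  `HeegnerDivisibilityX9` (20392), `KatoMuTransfer` (= `MuTransfer`, 19629), `AnalyticMuZeroOnClassX9`
  (= `AnalyticMuZeroX9`, 19630): a Schneider-free assembly (crux 19631 unused).

References: [Cha2005] Rmk. 25; [MatarNekovar2019] §0.11, Prop. 5.26 (2); [Jetchev2008] Conj. 1.3;
[BurungaleCastellaSkinner2025] Thm. 1.2.4 (a), Prop. 4.2.2, Cor. 1.3.1; [JetchevSkinnerWan2017] Thm. 3.3.1;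
[McCallumLMS1991] §5 Cor. 5.6; [Darmon2004] Thm. 3.6; route file `Theses/PrintX9.lean` (rev 0).
-/

set_option linter.dupNamespace false
set_option autoImplicit false

noncomputable section

open scoped Classical MatrixGroups ModularForm

open CongruenceSubgroup WeierstrassCurve NumberField IsDedekindDomain
  Literature.NumberTheory.EllipticCurves Literature.NumberTheory.EllipticCurves.ModularForms
  Literature.NumberTheory.EllipticCurves.BurungaleCastellaSkinner2025
  Literature.NumberTheory.EllipticCurves.JetchevSkinnerWan2017
  Summit.BirchSwinnertonDyer.BirchSwinnertonDyer.Theorems.Rank1ResidualX1Defs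
  Summit.BirchSwinnertonDyer.Rank1Residual
  Summit.BirchSwinnertonDyer.Rank1Residual.X11b.Three.Koly
  Summit.BirchSwinnertonDyer.Rank1Residual.X11b.KolyvaginBottom

open Literature.NumberTheory.EllipticCurves.Rank1Residual (GoodOrd Irr Surj BigIm
  norm_periodRatio_eq_one pPart_of_bsdp not_dvd_discr_of_split)

namespace Summit.BirchSwinnertonDyer.BirchSwinnertonDyer.Rank1Residual

/-! ### §1 The Tamagawa-sharp Kolyvagin bound over `K` at a GOOD prime with `E[p]` irreducible, from global divisibility -/

/-- **UPPER: the Tamagawa-sharpened Kolyvagin bound over `K` from global divisibility (one frame), at a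
GOOD prime `p` with `E[p]` IRREDUCIBLE, `E` without CM** — the good-`p` twin of
`Three.Koly.shaIndexBound_sharp_of_globalDivisibility_of_irreducible` (Cha's standing hypotheses: no CM
— a class hypothesis; `p² ∤ N_E` — good reduction at `p`; `p ∤ d_K` — `p` split in `K`): IF every
derived point `P_n` on the frame is `p^s`-divisible for all `s ≤ t` (`hglob`: `M_∞ ≥ t`) THEN
`ord_p #Ш(E/K) + 2t ≤ 2·ord_p [E(K):ℤP]` (Cha 2005 Rmk. 25 upper half `hChaU`, `p^{M₀} ∥ P`, index form
`ord_p[E(K):ℤP] = M₀`). CONDITIONAL on `hChaU` (flag `Cha05-Rmk25-structure`) and `hglob`.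
[cite: Cha2005, Thm. 21 and Rmk. 25 (pp. 173–175)] [cite: MatarNekovar2019, Thm. 0.7, §0.9, §0.11 (pp. 456–457)]
[cite: McCallumLMS1991, §5 Cor. 5.6 (p. 310) and Lemma 5.1 (p. 303)] -/
theorem X9.shaIndexBound_sharp_of_globalDivisibility
    (hChaU : Cha2005.rmk25_padicValNat_card_sha_primary_add_le_of_globalDivisibility)
    (W : WeierstrassCurve ℚ) [W.IsElliptic] [W.IsGloballyMinimal] [NeZero (W.conductorNorm ℤ)]
    (K : Type) [Field K] [NumberField K] (p : ℕ) [Fact p.Prime] (hp2 : p ≠ 2)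
    (hcm : ¬ W.HasCM) (hgood : W.HasGoodReductionAtPrime p) (hirr : Irr W p)
    (hK : IsImaginaryQuadratic K) (h3 : NumberField.discr K ≠ -3) (h4 : NumberField.discr K ≠ -4)
    (hHN : SatisfiesHeegnerHypothesis (W.conductorNorm ℤ) K) (hHp : SatisfiesHeegnerHypothesis p K)
    (Dt : ModularParametrizationData W (W.conductorNorm ℤ)) (β : ℤ) (ι : K →+* ℂ)
    (d₁ : KolyvaginHeegnerData Dt β ι 1) (P : (W.baseChange K).toAffine.Point)
    (hPd : d₁.toGeomPoints d₁.derivedPoint = toGeomPoints (W.baseChange K) P)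
    (hPinf : ¬ IsOfFinAddOrder P)
    (hrank : (W.baseChange K).mordellWeilRank = 1)
    (hiv : ∀ x : (W.baseChange K).toAffine.Point, p • x = 0 → x = 0)
    [Finite (W.baseChange K).sha] {t : ℕ}
    (hglob : ∀ (s : ℕ), s ≤ t → ∀ (n : ℕ) (d : KolyvaginHeegnerData Dt β ι n), Squarefree n →
      (∀ ℓ ∈ n.primeFactors, Zhang2014.IsKolyvaginPrime (W.conductorNorm ℤ) W K p ℓ ∧
        s ≤ Zhang2014.kolyvaginIndex W p ℓ) → PDiv d p s) :
    padicValNat p (Nat.card (W.baseChange K).sha) + 2 * t ≤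
      2 * padicValNat p (AddSubgroup.zmultiples P).index := by
  have hp : p.Prime := Fact.out
  -- Cha's standing hypotheses: `p² ∤ N` (good reduction at `p`), `p ∤ d_K` (`p` split)
  have hpN : ¬ p ∣ W.conductorNorm ℤ := fun h ↦
    (W.dvd_conductorNorm_iff_not_hasGoodReductionAtPrime p).mp h hgood
  have hpN2 : ¬ p ^ 2 ∣ W.conductorNorm ℤ := fun h ↦ hpN (dvd_trans (dvd_pow_self p two_ne_zero) h)
  have hpD : ¬ (p : ℤ) ∣ NumberField.discr K := not_dvd_discr_of_split hK hp hp2 hHp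
  -- the exponent p^{M₀} ∥ P (Mordell–Weil)
  haveI : Module.Finite ℤ (W.baseChange K).toAffine.Point := (W.baseChange K).module_finite_point_holds
  obtain ⟨M₀, x₀, hx₀, hmax⟩ := exists_pow_smul_eq_and_forall_ne hPinf (p := p) hp.two_le
  have hdiv : ∃ Q : (W.baseChange K).toAffine.Point, ((p ^ M₀ : ℕ) : ℤ) • Q = P :=
    ⟨x₀, by rw [natCast_zsmul]; exact hx₀⟩
  have hndiv : ¬ ∃ Q : (W.baseChange K).toAffine.Point, ((p ^ (M₀ + 1) : ℕ) : ℤ) • Q = P := by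
    rintro ⟨Q, hQ⟩
    exact hmax Q (by rw [← natCast_zsmul]; exact hQ)
  -- the structure theorem under irreducibility, upper form
  have hle : padicValNat p (Nat.card (AddCommGroup.primaryComponent (W.baseChange K).sha p)) + 2 * t ≤
      2 * M₀ :=
    hChaU W hcm K hK h3 h4 hHN p hp2 hpD hpN2 hirr Dt β ι d₁ P hPd hPinf M₀ hdiv hndiv t
      (fun s hs n d hn hℓ ↦ hglob s hs n d hn hℓ)
  -- `ord_p #Ш = ord_p #Ш[p^∞]` and `ord_p [E(K):ℤP] = M₀`
  have hsha : padicValNat p (Nat.card (AddCommGroup.primaryComponent (W.baseChange K).sha p)) =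
      padicValNat p (Nat.card (W.baseChange K).sha) :=
    padicValNat_card_addPrimaryComponent (A := (W.baseChange K).sha) p
  haveI : Finite (AddCommGroup.torsion (W.baseChange K).toAffine.Point) :=
    WeierstrassCurve.finite_torsion_point (W := W.baseChange K)
  obtain ⟨c, Q, hcQ, hcker⟩ := X11b.RankOne.exists_coord_of_mordellWeilRank_eq_one (W.baseChange K) hrank
  have hidx : padicValNat p (AddSubgroup.zmultiples P).index = M₀ :=
    padicValNat_index_zmultiples_eq_of_divisibility c Q hcQ hcker hiv P hdiv hndiv
  rw [hidx, ← hsha]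
  exact hle

/-! ### §2 STEP L + the sharp upper bound ⇒ the index identity over `K`, any Tamagawa depth -/

/-- **The Heegner-index identity over `K` from STEP L and the Tamagawa-sharp upper bound** (pure
arithmetic): `2·ord_p[E(K):ℤP] ≤ ord_p #Ш(E/K) + 2t` and `ord_p #Ш(E/K) + 2t ≤ 2·ord_p[E(K):ℤP]` with
`t = ord_p ∏_ℓ c_ℓ(E)` give `X11b.IndexIdentityAt W p K P`. [folklore] -/
theorem X9.indexIdentityAt_of_lowerBound_of_sharpUpper
    (W : WeierstrassCurve ℚ) [W.IsElliptic] (p : ℕ) [Fact p.Prime]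
    {K : Type} [Field K] [NumberField K] {P : (W.baseChange K).toAffine.Point}
    (hL : X11b.IndexLowerBoundAt W p K P)
    (hU : padicValNat p (Nat.card (W.baseChange K).sha) + 2 * padicValNat p W.tamagawaProduct ≤
      2 * padicValNat p (AddSubgroup.zmultiples P).index) :
    X11b.IndexIdentityAt W p K P := by
  unfold X11b.IndexLowerBoundAt at hL
  unfold X11b.IndexIdentityAt
  rw [WeierstrassCurve.shaOrder] at hL ⊢
  omega

/-! ### §3 Rank one at an X9 pair from crux J, the K6 typed rank-`0` engine and PUBLISHED facts — no Tamagawa restriction -/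

/-- **Rank one on class X9 at the pair, ANY Tamagawa numbers, from route `PrintX9`'s crux
`HeegnerDivisibilityX9` (`hJ`, item 20392), the K6 typed rank-`0` engine (`hIMC`) and PUBLISHED named
facts** — `PrintX9HeegnerRankOnePair.lean` §5c with Matar–Nekovář's depth-`0` STEP U REPLACED by §1 fed
by J: Hoffstein–Luo field with `|d_K| > max(B, 4)` for J's bound `B`, Darmon's conductor-`1` datum on
the Manin-good frame (`hD36`), its bottom point = the descent's `P` (Shimura reciprocity `hrec`), rank
one / finiteness over `K` (Kolyvagin), no `p`-torsion (irreducibility); STEP L from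
`PrintX9HeegnerIMCLink.lean` §4 + JSW 3.3.1 + Matar–Nekovář Prop. 5.26 (2); descent
`X11b.bsdp_of_indexIdentityAt` with the twist's rank-`0` `p`-part from `hIMC` (`classX9_twist_model`).
NO Schneider, NO (im), NO (sur), NO Tamagawa restriction. [cite: Cha2005, Rmk. 25 (p. 175)]
[cite: BurungaleCastellaSkinner2025, Thm. 1.2.4 (a), Prop. 4.2.2, Cor. 1.3.1 (proof, p. 4)]
[cite: JetchevSkinnerWan2017, Thm. 3.3.1, §7.4.1] [cite: MatarNekovar2019, Prop. 5.26 (2)]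
[cite: Darmon2004, Thm. 3.6] [cite: Miller2011LMS, Def. 1.1] -/
theorem X9.bsdp_rankOne_of_heegnerDivisibilityX9_of_x9IntegralMainConjecture
    -- published inputs (named facts of the tree)
    (hGZ : ∀ (N : ℕ) [NeZero N] (W : WeierstrassCurve ℚ) (K : Type) [Field K] [NumberField K],
      gross_zagier N W K)
    (hKo : ∀ (N : ℕ) [NeZero N] (W : WeierstrassCurve ℚ) (K : Type) [Field K] [NumberField K],
      kolyvagin N W K)
    (hrec : ∀ (N : ℕ) [NeZero N] (W : WeierstrassCurve ℚ) (K : Type) [Field K] [NumberField K],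
      heegnerPointOfConductor_one_galoisConj N W K)
    (hD36 : ∀ (N : ℕ) [NeZero N] (W : WeierstrassCurve ℚ) (K : Type) [Field K] [NumberField K],
      phi_heegnerTau_mem_singularModuliField N W K)
    (hChaU : Cha2005.rmk25_padicValNat_card_sha_primary_add_le_of_globalDivisibility)
    (h526 : MatarNekovar2019.prop526_hasIrreducibleModPGaloisRep_baseChange)
    (h124a : thm124a_prop422_thm513_generator_constantCoeff)
    (h331 : thm331_anticyclotomicControl)
    (hGr : greenberg_charValue_rankZero) (hGZK : rank_eq_analyticRank_of_analyticRank_le_one)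
    (hmod : hasEntireLFunction_rat) (hpar : nonempty_modularParametrizationData)
    (hnf : exists_isNewformOf) (hHL : HoffsteinLuo1997_exists_twist_L_one_ne_zero)
    (hMaz : mazur_not_dvd_maninConstant_of_odd) (hNS : integral_neronScaling_of_isGloballyMinimal)
    (h5 : realPeriodRat_eq_unit_mul_plusPeriod)
    -- the pair
    (W : WeierstrassCurve ℚ) [W.IsElliptic] [W.IsGloballyMinimal] (p : ℕ) [Fact p.Prime]
    (hX9 : ClassX9 W p) (hr : W.analyticRank = 1)
    -- route PrintX9's crux J (item 20392) and the K6 typed rank-`0` engine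
    (hJ : Summit.BirchSwinnertonDyer.BirchSwinnertonDyer.Theses.PrintX9.HeegnerDivisibilityX9)
    (hIMC : IntegralMainConjectureOnClassX9) : BSDp W p := by
  obtain ⟨hcm, hp5, hgood, hord, hirr, hns⟩ := id hX9
  have hpP : p.Prime := Fact.out
  have hp2 : p ≠ 2 := by omega
  haveI : NeZero (W.conductorNorm ℤ) := ⟨(W.conductorNorm_pos_holds).ne'⟩
  -- J's bound at the pair (census class predicate via `classX9_census_of_classX9`)
  obtain ⟨B, hB⟩ := hJ W p (classX9_census_of_classX9 W p hX9) hr.le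
  -- the sign of the functional equation is `−1`
  have hw : W.rootNumber = -1 := by
    rw [WeierstrassCurve.rootNumber_eq_neg_one_pow_analyticRank_of_exists_isNewformOf hnf W, hr]
    norm_num
  -- the field (Hoffstein–Luo) with `|d_K| > max(B, 4)`
  obtain ⟨d, hdneg, hsq, hd8, hBd, hjacS, hjacN, hLd⟩ :=
    exists_neg_fundamental_twist_ne_zero_of_hoffsteinLuo hnf hHL W hw {p} (max B 4)
  have hkr : ∀ q : ℕ, q.Prime → q ∣ W.conductorNorm ℤ * p →
      (q = 2 → d % 8 = 1) ∧ (q ≠ 2 → jacobiSym d q = 1) := by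
    intro q hq hqNp
    refine ⟨fun _ ↦ hd8, fun hq2 ↦ ?_⟩
    rcases (Nat.Prime.dvd_mul hq).mp hqNp with hqN | hqp
    · exact hjacN q hq hqN hq2
    · have hqp' : q = p := (Nat.prime_dvd_prime_iff_eq hq hpP).mp hqp
      subst hqp'
      exact hjacS q (Finset.mem_singleton_self q) hq hq2
  obtain ⟨K, _, _, hK, hBK, hH, hd8K, hLt⟩ :=
    (exists_heegnerField_iff_exists_fundamental (W.conductorNorm ℤ * p) (max B 4)
      (fun D ↦ D % 8 = 1 ∧ (W.quadraticTwist (D : ℚ)).entireLFunction 1 ≠ 0)).mpr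
      ⟨d, hdneg, Or.inl ⟨by omega, hsq, by omega⟩, hBd, hkr, hd8, hLd⟩
  have hneg : NumberField.discr K < 0 := IsImaginaryQuadratic.discr_neg hK
  have hodd : Odd (NumberField.discr K) := Int.odd_iff.mpr (by omega)
  have h4K : 4 < (NumberField.discr K).natAbs := lt_of_le_of_lt (le_max_right B 4) hBK
  have hBK' : B < (NumberField.discr K).natAbs := lt_of_le_of_lt (le_max_left B 4) hBK
  have hlt : NumberField.discr K < -4 := by omega
  have hHN : SatisfiesHeegnerHypothesis (W.conductorNorm ℤ) K := hH.of_dvd (dvd_mul_right _ _)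
  have hHp : SatisfiesHeegnerHypothesis p K := hH.of_dvd (dvd_mul_left _ _)
  have h3 : NumberField.discr K ≠ -3 := by omega
  have h4 : NumberField.discr K ≠ -4 := by omega
  -- `p ∤ d_K` and `w_K = 2`
  have hpd : ¬ (p : ℤ) ∣ NumberField.discr K := not_dvd_discr_of_split hK hpP hp2 hHp
  have hμ : ¬ p ∣ Units.torsionOrder K := by
    haveI : IsTotallyComplex K := hK.2
    rw [Literature.NumberTheory.DiophantineGeometry.torsionOrder_eq_two_of_discr_lt hK.1 hlt]
    intro hdvd
    have := Nat.le_of_dvd two_pos hdvd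
    omega
  -- (irred_K) at this field (Matar–Nekovář Prop. 5.26 (2))
  have hirrK : (W.baseChange K).HasIrreducibleModPGaloisRep p :=
    h526 W K hK.1 (Literature.SatisfiesHeegnerHypothesis.coprime_discr hK.1 hHN) p hp2 hirr
  -- the Manin-unit Heegner datum at the good prime `p`
  obtain ⟨Dt, H, ι, P, hP, hc⟩ :=
    X11b.exists_maninDatum_of_good hnf hMaz hNS W p (W.conductorNorm ℤ) K rfl hp2 hgood hirr hK hHN
  have hPinf : ¬ IsOfFinAddOrder P :=
    X11b.not_isOfFinAddOrder_of_heegner_of_analyticRank_eq_one W (W.conductorNorm ℤ) K Dt H ι P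
      (hGZ _ W K) hmod hr hK hHN hLt hP
  -- rank one and finiteness over `K` (Kolyvagin), no `p`-torsion (irreducibility)
  obtain ⟨hrank, hshaK⟩ := hKo (W.conductorNorm ℤ) W K hK hHN ⟨Dt, H, ι, hP⟩ hPinf
  haveI : Finite (W.baseChange K).sha := hshaK
  have hbot := torsionBy_eq_bot_of_isImaginaryQuadratic_of_hasIrreducibleModPGaloisRep W K hK hpP hirr
  have hiv : ∀ x : (W.baseChange K).toAffine.Point, p • x = 0 → x = 0 := fun x hx ↦ by
    have hmem : x ∈ AddSubgroup.torsionBy (W.baseChange K).toAffine.Point ((p : ℕ) : ℤ) := by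
      rw [mem_torsionBy_iff, natCast_zsmul]
      exact hx
    rw [hbot] at hmem
    exact hmem
  -- Darmon's conductor-1 datum on the frame (Dt, H.β, ι); its bottom point is `P`
  obtain ⟨d₁⟩ := exists_kolyvaginHeegnerData_one (hD36 _ W K) hK Dt H.β ι H.dvd_sq_sub
  have hPd : d₁.toGeomPoints d₁.derivedPoint = toGeomPoints (W.baseChange K) P :=
    toGeomPoints_derivedPoint_one_eq (hrec _ W K) hK hHN hP d₁ rfl
  have hd₁inf : ¬ IsOfFinAddOrder d₁.derivedPoint := fun hfin ↦
    hPinf ((isOfFinAddOrder_derivedPoint_one_iff (hrec _ W K) hK hHN hP d₁ rfl).mp hfin)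
  -- STEP U, Tamagawa-sharp: crux J at this frame + Cha Rmk. 25
  have hU : padicValNat p (Nat.card (W.baseChange K).sha) + 2 * padicValNat p W.tamagawaProduct ≤
      2 * padicValNat p (AddSubgroup.zmultiples P).index :=
    X9.shaIndexBound_sharp_of_globalDivisibility hChaU W K p hp2 hcm hgood hirr hK h3 h4 hHN hHp Dt
      H.β ι d₁ P hPd hPinf hrank hiv
      (fun s hs n dn hn hℓ ↦ hB K Dt H.β ι hK hBK' hHN hHp H.dvd_sq_sub hc d₁ hd₁inf s hs n dn hn hℓ)
  -- STEP L: (IMC≥∘BDP)ᵍ from BCS 1.2.4 (a) + 4.2.2 ∘ CGLS 5.1.3, control from JSW 3.3.1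
  obtain ⟨κ, γ, 𝔭, hκ, hγ, h𝔭⟩ := X11b.exists_anticyclotomic_generator_prime (p := p) hK
  haveI : Fact (κ.IsTopGenerator γ) := ⟨hγ⟩
  have hsplit : X11b.SplitsIn K p := hHp p Fact.out (dvd_refl p)
  obtain ⟨he, hf⟩ := X11b.degreeOne_of_splitsIn hK.1 hsplit h𝔭
  set ιp : K →+* ℚ_[p] := X11b.embAt K p 𝔭 h𝔭 he hf with hιp
  have hL : X11b.IndexLowerBoundAt W p K P :=
    X11b.indexLowerBoundAt_of_heegner_of_thm331_of_embedding (γ := γ) W p (W.conductorNorm ℤ) K Dt H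
      ι P h331 (hGZ _ W K) (hKo _ W K) hmod hGZK (by omega) hgood hr rfl hK hHN hHp hirrK hLt hP hκ ιp
      (X11b.imcLowerWaldspurgerOnTreeGoodAt_inducedPlace_of_heegner_of_thm124a_of_thm331 (γ := γ) W p
        (W.conductorNorm ℤ) K Dt H ι P h124a h331 (hKo _ W K) (by omega) ⟨hgood, hord⟩ hirr hirrK rfl
        hK hodd hlt hHN hHp hP hc hPinf hκ ιp)
  -- the identity over `K`
  have hid : Finite (W.baseChange K).sha → X11b.IndexIdentityAt W p K P := fun _ ↦
    X9.indexIdentityAt_of_lowerBound_of_sharpUpper W p hL hU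
  -- a globally minimal model of the twist (Néron), its X9 transports, its rank-`0` `p`-part
  have hD0 : (NumberField.discr K : ℚ) ≠ 0 := by exact_mod_cast NumberField.discr_ne_zero K
  haveI hEt : (W.quadraticTwist (NumberField.discr K : ℚ)).IsElliptic :=
    W.isElliptic_quadraticTwist hD0
  obtain ⟨Cd, hCd⟩ := hasGlobalMinimalModel_rat_holds (W.quadraticTwist (NumberField.discr K : ℚ))
  haveI : (Cd • W.quadraticTwist (NumberField.discr K : ℚ)).IsGloballyMinimal := hCd
  have hWd : Cd • W.quadraticTwist (NumberField.discr K : ℚ) =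
      Cd • W.quadraticTwist (NumberField.discr K : ℚ) := rfl
  have hX9d : ClassX9 (Cd • W.quadraticTwist (NumberField.discr K : ℚ)) p :=
    classX9_twist_model hX9 K hK.1 hpd Cd hWd
  have hordd : GoodOrd (Cd • W.quadraticTwist (NumberField.discr K : ℚ)) p :=
    ⟨hX9d.2.2.1, hX9d.2.2.2.1⟩
  have htam : padicValNat p (Cd • W.quadraticTwist (NumberField.discr K : ℚ)).tamagawaProduct =
      padicValNat p W.tamagawaProduct :=
    X2.padicValNat_tamagawaProduct_twist_of_heegner_of_odd W p hp2 K hK hodd hpd hHN Cd hWd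
  have hu : padicValRat p (Cd.u : ℚ) = 0 :=
    X11b.padicValRat_u_eq_zero_of_twist_good W p hpd hgood Cd hWd hordd.1
  have hMCd : MazurMainConjecture (Cd • W.quadraticTwist (NumberField.discr K : ℚ)) p :=
    mazurMainConjecture_of_integralMainConjectureOnClassX9 h5 hIMC hX9d
  -- the twist's rank-`0` `p`-part from its main conjecture
  have hLt' : (W.quadraticTwist (NumberField.discr K : ℚ)).entireLFunction =
      (Cd • W.quadraticTwist (NumberField.discr K : ℚ)).entireLFunction := by
    rw [entireLFunction_smul]
  have hLd1 : (Cd • W.quadraticTwist (NumberField.discr K : ℚ)).entireLFunction 1 ≠ 0 := by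
    rw [← hLt']; exact hLt
  have hfinSd : Finite (Cd • W.quadraticTwist (NumberField.discr K : ℚ)).sha :=
    (hGZK (Cd • W.quadraticTwist (NumberField.discr K : ℚ)) (by
      rw [((Cd • W.quadraticTwist (NumberField.discr K : ℚ)).analyticRank_eq_zero_iff_holds
        (hmod _)).2 hLd1]; exact zero_le_one)).2
  have htw := padicValRat_bsd_rank_zero_of_mazurMainConjecture
    (Cd • W.quadraticTwist (NumberField.discr K : ℚ)) p hordd.1 hordd.2 hLd1 hfinSd hpar
    (fun κ' γ' hκ' hγ' hγ'' D _ hX fE hfE hSel ↦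
      hGr (Cd • W.quadraticTwist (NumberField.discr K : ℚ)) p hp2 hordd.1 hordd.2 κ' γ' hκ' hγ' hγ''
        D hX fE hfE hSel) hMCd
  exact X11b.bsdp_of_indexIdentityAt W p (W.conductorNorm ℤ) K Dt H ι P (hGZ _ W K) (hKo _ W K) hGZK
    hmod hK hHN hP hp2 hc hμ hr hLt (Cd • W.quadraticTwist (NumberField.discr K : ℚ)) Cd hWd htw htam
    hu hid

/-! ### §4 The LEAF from crux J, the K6 rank-`0` engine and PUBLISHED facts: a Schneider-free assembly for route `PrintX9` -/

/-- **`BSDpOnClassX9` ⟸ PUBLISHED named facts ∧ `HeegnerDivisibilityX9` (route `PrintX9` crux,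
item 20392) ∧ `IntegralMainConjectureOnClassX9` (K6 typed rank-`0` engine) — no residual, no
Schneider certificate.** Rank `0`: the engine at the pair (CGLS 5.1.4's chain). Rank `1`: §3.
PUBLISHED binders: Gross–Zagier, Kolyvagin, Shimura reciprocity at conductor `1` (`hrec`), Darmon
2004 Thm. 3.6 (`hD36`), Cha 2005 Rmk. 25 upper half (`hChaU`, flag `Cha05-Rmk25-structure`),
Matar–Nekovář 2019 Prop. 5.26 (2) (`h526`), BCS 2025 Thm. 1.2.4 (a) + Prop. 4.2.2 ∘ CGLS 2022 Thm.
5.1.3 (`h124a`, flags `BCS25-124a+422-mu-composite` / `BCS25-IMC-equiv@BSTW`), JSW 2017 Thm. 3.3.1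
(`h331`), Greenberg 4.1, GZK, modularity ×3, Hoffstein–Luo, Mazur's Manin constant, Néron scaling,
the period unit. Conversion to the print shape by `pPart_of_bsdp` / `pPartBSD_iff_pPart`. Nothing is
booked: `hJ` and `hIMC` are OPEN route/K6 items. [cite: BurungaleCastellaSkinner2025, Cor. 1.3.1 and its proof (p. 4)]
[cite: Cha2005, Rmk. 25 (p. 175)] [cite: Jetchev2008, Conj. 1.3] [cite: Miller2011LMS, §1 and Def. 1.1] -/
theorem bsdpOnClassX9_of_heegnerDivisibilityX9_of_integralMainConjectureOnClassX9
    (hGZ : ∀ (N : ℕ) [NeZero N] (W : WeierstrassCurve ℚ) (K : Type) [Field K] [NumberField K],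
      gross_zagier N W K)
    (hKo : ∀ (N : ℕ) [NeZero N] (W : WeierstrassCurve ℚ) (K : Type) [Field K] [NumberField K],
      kolyvagin N W K)
    (hrec : ∀ (N : ℕ) [NeZero N] (W : WeierstrassCurve ℚ) (K : Type) [Field K] [NumberField K],
      heegnerPointOfConductor_one_galoisConj N W K)
    (hD36 : ∀ (N : ℕ) [NeZero N] (W : WeierstrassCurve ℚ) (K : Type) [Field K] [NumberField K],
      phi_heegnerTau_mem_singularModuliField N W K)
    (hChaU : Cha2005.rmk25_padicValNat_card_sha_primary_add_le_of_globalDivisibility)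
    (h526 : MatarNekovar2019.prop526_hasIrreducibleModPGaloisRep_baseChange)
    (h124a : thm124a_prop422_thm513_generator_constantCoeff)
    (h331 : thm331_anticyclotomicControl)
    (hGr : greenberg_charValue_rankZero) (hGZK : rank_eq_analyticRank_of_analyticRank_le_one)
    (hmod : hasEntireLFunction_rat) (hpar : nonempty_modularParametrizationData)
    (hnf : exists_isNewformOf) (hHL : HoffsteinLuo1997_exists_twist_L_one_ne_zero)
    (hMaz : mazur_not_dvd_maninConstant_of_odd) (hNS : integral_neronScaling_of_isGloballyMinimal)
    (h5 : realPeriodRat_eq_unit_mul_plusPeriod)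
    (hJ : Summit.BirchSwinnertonDyer.BirchSwinnertonDyer.Theses.PrintX9.HeegnerDivisibilityX9)
    (hIMC : IntegralMainConjectureOnClassX9) : BSDpOnClassX9 := by
  intro W _ _ p _ hran hX9 _
  obtain ⟨-, hp5, hgood, hord, -, -⟩ := id hX9
  have hbsdp : BSDp W p := by
    rcases Nat.lt_or_ge W.analyticRank 1 with h0 | h1
    · exact bsdp_of_mazurMainConjecture_of_analyticRank_eq_zero hGr hpar hGZK (by omega) ⟨hgood, hord⟩
        (by omega) (mazurMainConjecture_of_integralMainConjectureOnClassX9 h5 hIMC hX9)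
    · exact X9.bsdp_rankOne_of_heegnerDivisibilityX9_of_x9IntegralMainConjecture hGZ hKo hrec hD36 hChaU
        h526 h124a h331 hGr hGZK hmod hpar hnf hHL hMaz hNS h5 W p hX9 (le_antisymm hran h1) hJ hIMC
  exact (pPartBSD_iff_pPart W p).mpr (pPart_of_bsdp hmod hGZK W p hran hbsdp)

/-- **The Schneider-free ASSEMBLY of route `PrintX9` from its items: `HeegnerDivisibilityX9` (20392)
→ `KatoMuTransfer` (= `MuTransfer`, 19629) → `AnalyticMuZeroOnClassX9` (= `AnalyticMuZeroX9`, 19630)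
→ PUBLISHED facts → `BSDpOnClassX9`** (the K6 leaf; the route's W-ALL/9 corner follows by the landed
`wallCornerX9_of_bsdpOnClassX9`). Compared with the route's `Assembly` (20394): the crux
`SchneiderX9RankOne` (19631, open-problem grade) is NOT used; the Kato-side `μ`-transfer (19629,
kernel-checked modulo Kato's package F1) is used instead, at the rank-`0` twists only.
[cite: BurungaleCastellaSkinner2025, Thm. 1.1.2 (a), Cor. 1.3.1] [cite: Cha2005, Rmk. 25]
[cite: Kato2004Asterisque, Thm. 12.5, 17.4] [cite: GreenbergLNM1716, Conj. 1.11, Thm. 4.1] -/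
theorem bsdpOnClassX9_of_heegnerDivisibilityX9_of_katoMuTransfer
    (hGZ : ∀ (N : ℕ) [NeZero N] (W : WeierstrassCurve ℚ) (K : Type) [Field K] [NumberField K],
      gross_zagier N W K)
    (hKo : ∀ (N : ℕ) [NeZero N] (W : WeierstrassCurve ℚ) (K : Type) [Field K] [NumberField K],
      kolyvagin N W K)
    (hrec : ∀ (N : ℕ) [NeZero N] (W : WeierstrassCurve ℚ) (K : Type) [Field K] [NumberField K],
      heegnerPointOfConductor_one_galoisConj N W K)
    (hD36 : ∀ (N : ℕ) [NeZero N] (W : WeierstrassCurve ℚ) (K : Type) [Field K] [NumberField K],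
      phi_heegnerTau_mem_singularModuliField N W K)
    (hChaU : Cha2005.rmk25_padicValNat_card_sha_primary_add_le_of_globalDivisibility)
    (h526 : MatarNekovar2019.prop526_hasIrreducibleModPGaloisRep_baseChange)
    (h124a : thm124a_prop422_thm513_generator_constantCoeff)
    (h331 : thm331_anticyclotomicControl)
    (hBCS : burungale_castella_skinner_charIdeal_eq_padicLFunction)
    (hGr : greenberg_charValue_rankZero) (hGZK : rank_eq_analyticRank_of_analyticRank_le_one)
    (hmod : hasEntireLFunction_rat) (hpar : nonempty_modularParametrizationData)
    (hnf : exists_isNewformOf) (hHL : HoffsteinLuo1997_exists_twist_L_one_ne_zero)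
    (hMaz : mazur_not_dvd_maninConstant_of_odd) (hNS : integral_neronScaling_of_isGloballyMinimal)
    (h5 : realPeriodRat_eq_unit_mul_plusPeriod)
    -- route PrintX9 / K6 items
    (hJ : Summit.BirchSwinnertonDyer.BirchSwinnertonDyer.Theses.PrintX9.HeegnerDivisibilityX9)
    (h1 : KatoMuTransfer) (h2 : AnalyticMuZeroOnClassX9) : BSDpOnClassX9 :=
  bsdpOnClassX9_of_heegnerDivisibilityX9_of_integralMainConjectureOnClassX9 hGZ hKo hrec hD36 hChaU h526
    h124a h331 hGr hGZK hmod hpar hnf hHL hMaz hNS h5 hJ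
    (integralMainConjectureOnClassX9_of_katoMuTransfer hBCS h1 h2)

end Summit.BirchSwinnertonDyer.BirchSwinnertonDyer.Rank1Residual

end
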